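import Literature.Probability.RandomPlanarGeometry.RestrictionMeasuresFiveEighths
import Literature.Probability.RandomPlanarGeometry.SLEKappaRhoFillVersionProofs
import Literature.Probability.RandomPlanarGeometry.SLEKappaRhoBesselEquation
import Literature.Probability.RandomPlanarGeometry.SLEKappaRhoDrivingProofs
import Literature.Probability.RandomPlanarGeometry.SLERestrictionLemmasProofs
import Literature.Probability.RandomPlanarGeometry.SLERestrictionSmoothProofs
import Literature.Probability.RandomPlanarGeometry.RohdeSchrammCor35Proofs
import HarnessLib

/-!
# [LSW] Cor. 8.6 (`not_exists_isRestrictionMeasure_of_lt_five_eighths`): the symmetry sentence discharged, and the corollary from the two remaining leaves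

Proof-only sibling of `RestrictionMeasuresFiveEighths` (no definition, no named fact), for the
named fact
`Literature.Probability.RandomPlanarGeometry.not_exists_isRestrictionMeasure_of_lt_five_eighths`,
after

* G. F. Lawler, O. Schramm, W. Werner, *Conformal restriction: the chordal case*, J. Amer. Math.
  Soc. **16** (2003) 917–955, arXiv:math/0209343 (**[LSW]**; arXiv page numbers), Cor. 8.6
  (p. 37): "For all `α < 5/8`, the two-sided restriction probability measure `P_α` does not
  exist", with its proof (p. 38): "When `ρ` spans `(−2, ∞)`, `α` spans `(0, ∞)` […] Suppose
  now that `α < 5/8` […] `K̃ := F^{ℝ₊}_ℍ(K)` […] has the same law as `cl(K_∞)` for SLE(8/3, ρ)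
  […] `ρ < 0`. Note that when `ρ < 0`, `W_t − √κ B_t` is decreasing. It follows easily that the
  probability that `i` ends up eventually to 'the right' of the right hand boundary of
  SLE(8/3, ρ) […] is strictly larger than the corresponding quantity for SLE(8/3, 0), which is
  `1/2` by symmetry. On the other hand, by symmetry […] at most `1/2`";
* S. Rohde, O. Schramm, *Basic properties of SLE*, Ann. of Math. **161** (2005) 883–924
  (**[RS05]**), Thm. 5.1 (SLE_κ is generated by a curve, `κ ≠ 8`).

The printed proof of Cor. 8.6 is assembled in the tree
(`not_exists_isRestrictionMeasure_of_lt_five_eighths_of_sleKappaRho`, `SLEKappaRho`; the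
two-sided half — `F^{ℝ₊}_ℍ(P_α) = P⁺_α` and `P_α(i right of K) ≤ 1/2` — being proved in
`RestrictionLeftFillLaw`) from [LSW] Thm. 8.4 in law form
(`SLEKappaRho.isRightRestrictionMeasure_fill`) and the asymmetry of SLE(8/3, ρ), `ρ < 0`
(`SLEKappaRho.one_half_lt_measure_I_notMem_fill`), themselves reduced
(`RestrictionMeasuresFiveEighthsAssembly`: `…_of_six_leaves`) to six printed leaves. Four of the
six are now theorems of the tree: Lemma 6.2 (`Loewner.restrictionDeriv_exitTime_gt_holds`,
`SLERestrictionLemmasProofs`), Lemma 6.3 (`IsSmoothHull.restrictionDerivVanishesAtHit_holds`,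
`SLERestrictionSmoothProofs`), Lemma 8.3 (2) on the positive axis
(`SLEKappaRho.swallowingTime_ofReal_pos_holds`, `SLEKappaRhoAssemblyProofs`), and [RS05]
Thm. 5.1 (`hasSLETrace_of_ne_eight_holds`, `RohdeSchrammCor35Proofs`), to which the symmetry
sentence had been reduced (`measure_I_notMem_leftFilling_sle_eq_half_of_RS05`,
`SLEKappaRhoDrivingProofs`). This file records the consequences:

* `Literature.Probability.RandomPlanarGeometry.measure_I_notMem_leftFilling_sle_eq_half_holds` —
  **DISCHARGE** of the named fact `measure_I_notMem_leftFilling_sle_eq_half` (`SLEKappaRhoDriving`):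
  "the corresponding quantity for SLE(8/3, 0), which is `1/2` by symmetry" —
  `P{i ∉ F^{ℝ₊}_ℍ(cl K_∞(√(8/3) B))} = 1/2`;
* `Literature.Probability.RandomPlanarGeometry.SLEKappaRho.measure_I_notMem_fill_eq_half_holds` —
  **DISCHARGE** of the named fact `SLEKappaRho.measure_I_notMem_fill_eq_half`
  (`SLEKappaRhoAsymmetry`): the same sentence for SLE(8/3, 0) driving pairs (through the Bessel
  identity of §8.3, `SLEKappaRho.integral_inv_eq_holds`, and `SLEKappaRho.measure_I_notMem_fill_eq_half_of`);
* [LSW] Thm. 8.4 (law form and avoidance formula) and Prop. 8.1 (existence of `P⁺_α`, all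
  `α > 0`) from the SINGLE remaining leaf of §8.4, the one-sided restriction martingale of
  Lemmas 8.9–8.10 (`SLEKappaRho.isRightRestrictionMeasure_fill_of_martingale`,
  `SLEKappaRho.measure_fill_disjoint_of_martingale`, `exists_isRightRestrictionMeasure_of_martingale`);
* the asymmetry `SLEKappaRho.one_half_lt_measure_I_notMem_fill` from the single remaining
  sentence of p. 38, the comparison `SLEKappaRho.measure_I_notMem_fill_lt_of_neg`, to which it is
  now EQUIVALENT (`SLEKappaRho.one_half_lt_measure_I_notMem_fill_of_comparison`,
  `SLEKappaRho.measure_I_notMem_fill_lt_of_neg_iff`); and its non-strict half `≥ 1/2` from the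
  martingale leaf alone (`SLEKappaRho.one_half_le_measure_I_notMem_fill_of_martingale`);
* hence the Cor. 8.6 input `exists_isRightRestrictionMeasure_lt_five_eighths`
  (`OneSidedRestriction`) and **[LSW] Cor. 8.6 from the TWO remaining leaves**
  (`exists_isRightRestrictionMeasure_lt_five_eighths_of_two_leaves`,
  `not_exists_isRestrictionMeasure_of_lt_five_eighths_of_two_leaves`): the martingale of
  Lemmas 8.9–8.10 (`SLEKappaRho.exists_isOneSidedMartingale`, `SLEKappaRhoRestriction`) and the
  comparison sentence (`SLEKappaRho.measure_I_notMem_fill_lt_of_neg`, `SLEKappaRhoAsymmetry`).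

So the discharge `not_exists_isRestrictionMeasure_of_lt_five_eighths_holds` is exactly
`not_exists_isRestrictionMeasure_of_lt_five_eighths_of_two_leaves` applied to the two `_holds`
theorems of these named facts, once they exist. No new named fact is introduced.

Mathlib: none beyond the imports. Tree: the assemblies and discharges quoted above.
-/

noncomputable section

open scoped NNReal ENNReal
open Literature.Probability.Process (preWienerMeasure)

namespace Literature.Probability.RandomPlanarGeometry

/-! ### "Which is `1/2` by symmetry": the two forms of the symmetry sentence, discharged -/

/-- **DISCHARGE of `measure_I_notMem_leftFilling_sle_eq_half`** ([LSW] proof of Cor. 8.6,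
p. 38: "the corresponding quantity for SLE(8/3, 0), which is `1/2` by symmetry"): for the
SLE_{8/3} driving function `√(8/3) B`, `P{i ∉ F^{ℝ₊}_ℍ(cl K_∞)} = 1/2`. The tree's reduction to
the Rohde–Schramm trace theorem (`measure_I_notMem_leftFilling_sle_eq_half_of_RS05`: reflection
invariance of the Wiener measure, `Loewner.hull_imagAxisRefl`, and "a.s. `i` lies on exactly one
side of the simple transient SLE_{8/3} trace") fed with [RS05] Thm. 5.1, now a theorem of the
tree (`hasSLETrace_of_ne_eight_holds`).
[cite: LawlerSchrammWerner2003Restriction, proof of Cor. 8.6 (p. 38), second sentence ("which is 1/2 by symmetry")] -/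
theorem measure_I_notMem_leftFilling_sle_eq_half_holds : measure_I_notMem_leftFilling_sle_eq_half :=
  measure_I_notMem_leftFilling_sle_eq_half_of_RS05 hasSLETrace_of_ne_eight_holds

/-- **DISCHARGE of `SLEKappaRho.measure_I_notMem_fill_eq_half`** ([LSW] proof of Cor. 8.6,
p. 38, with §8.3: "Note that when `ρ = 0`, we get the ordinary chordal SLE_κ"): for every
SLE(8/3, 0) driving pair `(O, W)`, `P{i ∉ F^{ℝ₊}_ℍ(cl K_∞(W))} = 1/2` — from the SLE_{8/3} form
just discharged and the Bessel identity `∫₀ᵗ du/Z_u = (Z_t − √κ B_t)/(ρ + 2)` of §8.3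
(`SLEKappaRho.integral_inv_eq_holds`, giving `W = √κ B` a.s. for `ρ = 0`), through
`SLEKappaRho.measure_I_notMem_fill_eq_half_of`.
[cite: LawlerSchrammWerner2003Restriction, proof of Cor. 8.6 (p. 38), second sentence, with §8.3 (SLE(κ, 0) = SLE_κ)] -/
theorem SLEKappaRho.measure_I_notMem_fill_eq_half_holds : SLEKappaRho.measure_I_notMem_fill_eq_half :=
  SLEKappaRho.measure_I_notMem_fill_eq_half_of SLEKappaRho.integral_inv_eq_holds
    measure_I_notMem_leftFilling_sle_eq_half_holds

/-! ### [LSW] Thm. 8.4 and Prop. 8.1 from the single remaining leaf of §8.4 -/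

/-- **[LSW] Thm. 8.4 in law form from the martingale of Lemmas 8.9–8.10 alone**: the law of the
`Ω₊`-valued version of `K = F^{ℝ₊}_ℍ(cl K_∞)` for SLE(8/3, ρ), `ρ > −2`, is `P⁺_{α(ρ)}`,
`α(ρ) = (3ρ + 10)(2 + ρ)/32`, given the one-sided restriction martingale
(`SLEKappaRho.exists_isOneSidedMartingale`). The tree's three-leaf assembly
(`SLEKappaRho.isRightRestrictionMeasure_fill_of_three_leaves`) with Lemma 6.2
(`Loewner.restrictionDeriv_exitTime_gt_holds`) and Lemma 6.3
(`IsSmoothHull.restrictionDerivVanishesAtHit_holds`) now proved.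
[cite: LawlerSchrammWerner2003Restriction, Thm. 8.4 (p. 37) and its proof (§8.4)] -/
theorem SLEKappaRho.isRightRestrictionMeasure_fill_of_martingale
    (hM : SLEKappaRho.exists_isOneSidedMartingale) : SLEKappaRho.isRightRestrictionMeasure_fill :=
  SLEKappaRho.isRightRestrictionMeasure_fill_of_three_leaves hM
    Loewner.restrictionDeriv_exitTime_gt_holds IsSmoothHull.restrictionDerivVanishesAtHit_holds

/-- **The avoidance formula of [LSW] Thm. 8.4, `P[F^{ℝ₊}_ℍ(cl K_∞) ∩ A = ∅] = Φ_A'(0)^α` for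
`A ∈ 𝒬₊`, from the martingale of Lemmas 8.9–8.10 alone** (the named fact
`SLEKappaRho.measure_fill_disjoint`): the weak-leaf assembly
(`SLEKappaRho.measure_fill_disjoint_of_weak_leaves`) with `∫₀ᵗ du/Z_u < ∞`
(`SLEKappaRho.integral_inv_eq_holds`), Lemma 6.2, Lemma 6.3 and Lemma 8.3 (2) on the positive
axis (`SLEKappaRho.swallowingTime_ofReal_pos_holds`) proved.
[cite: LawlerSchrammWerner2003Restriction, Thm. 8.4 (p. 37) and its proof (§8.4)] -/
theorem SLEKappaRho.measure_fill_disjoint_of_martingale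
    (hM : SLEKappaRho.exists_isOneSidedMartingale) : SLEKappaRho.measure_fill_disjoint :=
  SLEKappaRho.measure_fill_disjoint_of_weak_leaves
    (SLEKappaRho.intervalIntegrable_inv_of SLEKappaRho.integral_inv_eq_holds) hM
    Loewner.restrictionDeriv_exitTime_gt_holds IsSmoothHull.restrictionDerivVanishesAtHit_holds
    SLEKappaRho.swallowingTime_ofReal_pos_holds

/-- **[LSW] Prop. 8.1, first sentence ("The right-sided restriction measures `P⁺_α` exist for
all `α > 0`"), from the martingale of Lemmas 8.9–8.10 alone** — the named fact
`exists_isRightRestrictionMeasure` (`OneSidedRestrictionFacts`) through Thm. 8.4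
(`exists_isRightRestrictionMeasure_of_sleKappaRho`; [LSW] prove Prop. 8.1 by reflected Brownian
excursions, §8.2, and note on p. 38 that Thm. 8.4 gives it again: "When `ρ` spans `(−2, ∞)`,
`α` spans `(0, ∞)`").
[cite: LawlerSchrammWerner2003Restriction, Prop. 8.1 (§8.2) via Thm. 8.4 (p. 37) and p. 38] -/
theorem exists_isRightRestrictionMeasure_of_martingale
    (hM : SLEKappaRho.exists_isOneSidedMartingale) : exists_isRightRestrictionMeasure :=
  exists_isRightRestrictionMeasure_of_sleKappaRho
    (SLEKappaRho.isRightRestrictionMeasure_fill_of_martingale hM)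

/-! ### The asymmetry of SLE(8/3, ρ), `ρ < 0`, from the comparison sentence alone -/

/-- **`P{i ∉ F^{ℝ₊}_ℍ(cl K_∞)} > 1/2` for SLE(8/3, ρ), `−2 < ρ < 0`, from the comparison
sentence of p. 38 alone** (`SLEKappaRho.measure_I_notMem_fill_lt_of_neg`: the SLE(8/3, ρ)
probability is strictly larger than the SLE(8/3, 0) one), the value `1/2` for SLE(8/3, 0) being
the theorem `SLEKappaRho.measure_I_notMem_fill_eq_half_holds`.
[cite: LawlerSchrammWerner2003Restriction, proof of Cor. 8.6 (p. 38), first two sentences] -/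
theorem SLEKappaRho.one_half_lt_measure_I_notMem_fill_of_comparison
    (hlt : SLEKappaRho.measure_I_notMem_fill_lt_of_neg) :
    SLEKappaRho.one_half_lt_measure_I_notMem_fill :=
  SLEKappaRho.one_half_lt_measure_I_notMem_fill_of SLEKappaRho.measure_I_notMem_fill_eq_half_holds
    hlt

/-- With the symmetry sentence proved, **the comparison sentence and the asymmetry are
equivalent** named facts (`SLEKappaRho.measure_I_notMem_fill_lt_of_neg_of` for the converse).
[cite: LawlerSchrammWerner2003Restriction, proof of Cor. 8.6 (p. 38), first two sentences] -/
theorem SLEKappaRho.measure_I_notMem_fill_lt_of_neg_iff :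
    SLEKappaRho.measure_I_notMem_fill_lt_of_neg ↔ SLEKappaRho.one_half_lt_measure_I_notMem_fill :=
  ⟨SLEKappaRho.one_half_lt_measure_I_notMem_fill_of_comparison,
    SLEKappaRho.measure_I_notMem_fill_lt_of_neg_of SLEKappaRho.measure_I_notMem_fill_eq_half_holds⟩

/-- **The non-strict half `P{i ∉ F^{ℝ₊}_ℍ(cl K_∞)} ≥ 1/2` (`−2 < ρ < 0`) from the martingale of
Lemmas 8.9–8.10 alone**: Thm. 8.4 for all `ρ > −2` (from `hM`), the semigroup of one-sided
measures (§8.2, `IsRightRestrictionMeasure.fillUnion`) and the symmetry sentence, through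
`SLEKappaRho.one_half_le_measure_I_notMem_fill_of`. (The strict inequality printed on p. 38 is
what the comparison leaf adds: it amounts to `P⁺_{5/8 − α(ρ)}{i ∈ K} > 0`.)
[cite: LawlerSchrammWerner2003Restriction, proof of Cor. 8.6 (p. 38) with Thm. 8.4 (p. 37) and §8.2 (sentence preceding Prop. 8.1)] -/
theorem SLEKappaRho.one_half_le_measure_I_notMem_fill_of_martingale
    (hM : SLEKappaRho.exists_isOneSidedMartingale) {ρ : ℝ} {O W : ℝ≥0 → (ℝ≥0 → ℝ) → ℝ}
    (hρ : -2 < ρ) (hρ0 : ρ < 0) (hOW : IsSLEKappaRhoPair (8 / 3) ρ O W) :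
    1 / 2 ≤ preWienerMeasure {ω | Complex.I ∉ sleKappaRhoFill W ω} :=
  SLEKappaRho.one_half_le_measure_I_notMem_fill_of
    (SLEKappaRho.isRightRestrictionMeasure_fill_of_martingale hM)
    SLEKappaRho.measure_I_notMem_fill_eq_half_holds hρ hρ0 hOW

/-! ### [LSW] Cor. 8.6 from the two remaining leaves -/

/-- **The Cor. 8.6 input from the two remaining leaves**: the bundled fact
`exists_isRightRestrictionMeasure_lt_five_eighths` (`OneSidedRestriction`: for `0 < α < 5/8`,
`P⁺_α` exists and `P⁺_α{i ∉ K} > 1/2`) from the martingale of Lemmas 8.9–8.10 (`hM`) and the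
comparison sentence of p. 38 (`hlt`), through `exists_isRightRestrictionMeasure_lt_five_eighths_of_sleKappaRho`.
[cite: LawlerSchrammWerner2003Restriction, proof of Cor. 8.6 (p. 38) with Thm. 8.4 (p. 37)] -/
theorem exists_isRightRestrictionMeasure_lt_five_eighths_of_two_leaves
    (hM : SLEKappaRho.exists_isOneSidedMartingale)
    (hlt : SLEKappaRho.measure_I_notMem_fill_lt_of_neg) :
    exists_isRightRestrictionMeasure_lt_five_eighths :=
  exists_isRightRestrictionMeasure_lt_five_eighths_of_sleKappaRho
    (SLEKappaRho.isRightRestrictionMeasure_fill_of_martingale hM)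
    (SLEKappaRho.one_half_lt_measure_I_notMem_fill_of_comparison hlt)

/-- **[LSW] Corollary 8.6 from the two remaining leaves** ("For all `α < 5/8`, the two-sided
restriction probability measure `P_α` does not exist", the named fact
`not_exists_isRestrictionMeasure_of_lt_five_eighths`): the one-sided restriction martingale of
SLE(8/3, ρ) (Lemmas 8.9–8.10, `hM`) and the comparison of SLE(8/3, ρ), `ρ < 0`, with SLE(8/3, 0)
(p. 38, `hlt`); everything else in the printed proof — Thm. 8.4 from the martingale (Lemma 6.2,
Lemma 6.3, Lemma 8.3, §8.3, Kolmogorov's extension), "`1/2` by symmetry" ([RS05] Thm. 5.1,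
reflection invariance), `F^{ℝ₊}_ℍ(P_α) = P⁺_α`, the uniqueness of `P⁺_α` and
`P_α(i right of K) ≤ 1/2` — is proved in the tree. The discharge
`not_exists_isRestrictionMeasure_of_lt_five_eighths_holds` is this theorem applied to the two
`_holds` theorems, once they exist.
[cite: LawlerSchrammWerner2003Restriction, Cor. 8.6 (p. 37) and its proof (p. 38)] -/
theorem not_exists_isRestrictionMeasure_of_lt_five_eighths_of_two_leaves
    (hM : SLEKappaRho.exists_isOneSidedMartingale)
    (hlt : SLEKappaRho.measure_I_notMem_fill_lt_of_neg) :
    not_exists_isRestrictionMeasure_of_lt_five_eighths :=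
  not_exists_isRestrictionMeasure_of_lt_five_eighths_of_sleKappaRho
    (SLEKappaRho.isRightRestrictionMeasure_fill_of_martingale hM)
    (SLEKappaRho.one_half_lt_measure_I_notMem_fill_of_comparison hlt)

end Literature.Probability.RandomPlanarGeometry

end
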